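import Summits.ResolutionOfSingularities.ResolutionOfSingularities.Theses.PAlteration
import Summits.ResolutionOfSingularities.ResolutionOfSingularities.Theorems.PAlterationPalterationThesisGlue
import Summits.ResolutionOfSingularities.ResolutionOfSingularities.Theorems.PAlterationPalterationThesisIffSummit
import HarnessLib

/-!
# Skeleton `items-glue` for crux stmt-ResolutionOfSingularities-0552 `PalterationThesis`

Line lead gen 1 / c1 (prover-line-stmt-ResolutionOfSingularities-0552-c1-0), 2026-08-16.
The crux `PalterationThesis` is `∀ p prime, PIAlt_p ∧ PICover_p`, i.e. the conjunction of the two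
open crux ITEMS stmt-0555 (`Pialt`) and stmt-0554 (`Picover`) of the same route
(`palterationThesis_iff_pialt_and_picover`, landed p87934) and is equivalent to the summit
(`palterationThesis_iff_resolutionOfSingularities`, landed p95862). The only honest decomposition is
therefore the two items themselves; both stubs below ARE those items (crux-sized, each with its own
line lead) and are not worker-sized.
-/

namespace Summit.ResolutionOfSingularities.ResolutionOfSingularities.Theorems.PalterationThesisLine

open Summit.ResolutionOfSingularities.ResolutionOfSingularities.Theses.PAlteration
open Summit.ResolutionOfSingularities.ResolutionOfSingularities.Theorems

/-- Stub = item stmt-ResolutionOfSingularities-0555 (`Pialt`, Abramovich–Oort conjecture in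
characteristic `p`, Temkin 2013 Conj. 1.3.1; open). -/
theorem stub_pialt : Pialt := by
  sorry

/-- Stub = item stmt-ResolutionOfSingularities-0554 (`Picover`, resolution of finite radicial covers
of regular varieties; open from dimension 4). -/
theorem stub_picover : Picover := by
  sorry

/-- Composition: the crux BY NAME from the two stubs (pure glue, `palterationThesis_of_pialt_of_picover`). -/
theorem PalterationThesis_of : PalterationThesis :=
  palterationThesis_of_pialt_of_picover stub_pialt stub_picover

end Summit.ResolutionOfSingularities.ResolutionOfSingularities.Theorems.PalterationThesisLine
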